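import Mathlib
import Summits.CriticalPhenomena.CardyFormulaZ2.Theorems.CardySelfRefinementGradientComparabilityOfKernels
import Summits.CriticalPhenomena.CardyFormulaZ2.Theorems.CardySelfRefinementGradientComparabilityLevelCurves
import Summits.CriticalPhenomena.CardyFormulaZ2.Theorems.CardySelfRefinementGradientComparabilityStubLevelSetTransport
import Summits.CriticalPhenomena.CardyFormulaZ2.Theorems.CardySelfRefinementGradientComparabilityOfMonotoneLineCharts
import HarnessLib

/-!
# Crux `GradientComparability` (stmt-CriticalPhenomena-10269), line `monotone-product-coordinates`:
# the composition `GradientComparability_of_monotoneLine`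

Route `CardySelfRefinement`, sub-problem `CriticalPhenomena/CardyFormulaZ2`; vocabulary (`P`, `Dρ`,
`Dc`, `PathOK`, `M`, `ax`, `tb`, …) from `CardySelfRefinementDefs` (definitionally the route's
`let`-chain; `gradientComparability_iff` is `Iff.rfl`).  Importable form of §5 of the line skeleton
`Cruxes/GradientComparability/Lines/monotone_product_coordinates.lean`: the six registered stubs of
the line (`stub_monotoneRep`, `stub_slopeBounds`, `stub_bet`, `stub_cornerBet`, `stub_cornerPatch`,
`stub_windowAtRhoZero`, signatures inlined verbatim as hypotheses) imply the crux
`GradientComparability` BY NAME.  The seventh input of the line, the level-set transport (★), is the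
landed `stub_levelSetTransport`; the bulk and corner charts are `monotoneLine_charts`
(`…GradientComparabilityOfMonotoneLineCharts`).

* `MonotoneLine.overlap`: two charts of a continuous path `(1,0) → (0,½)` — one on `{ρ_s ≤ 1 − δ}`,
  one on `{ρ_s ≥ 1 − 2δ}` — overlap on `ρ ∈ [1−2δ, 1−δ]`, which the path visits (intermediate value
  theorem), so one global comparison constant results (clause (i)).
* `GradientComparability_of_monotoneLine` (registered): clause (i) by the overlap of the two charts;
  clause (ii) from clause (i) and the landed divergence at the Bernoulli endpoint `γ 1 = (0,½)`
  (`divergesAt_zero_half`).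
-/

noncomputable section

namespace Summit.CriticalPhenomena.CardyFormulaZ2.Theorems.CardySelfRefinement

open scoped Topology
open Filter Set MeasureTheory
open Literature.Probability.LatticeModels Literature.Probability.Percolation
open Literature.Probability.Percolation.QuadCrossing
open Summit.CriticalPhenomena.CardyFormulaZ2.Theses.CardySelfRefinement

namespace MonotoneLine

-- adapted from `comparability` of `…Theorems/CardySelfRefinementGradientComparabilityOfKernels.lean`
/-- **Overlap of two charts along the path.**  Let `γ` be a continuous path with `(γ 0).1 = 1` and
`(γ 1).1 = 0`, `G ≥ 0` a size function on its parameters and `δ ∈ (0,½]`.  If `G` is `Λ`-comparable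
between any two parameters with `ρ ≤ 1 − δ` and between any two with `ρ ≥ 1 − 2δ`, then it is
`(max Λ 1)²`-comparable between ANY two parameters: the path visits `ρ = 1 − 3δ/2` (intermediate
value theorem), a parameter lying in both charts. -/
theorem overlap {γ : unitInterval → ℝ × ℝ} (hγc : Continuous γ) (h0 : (γ 0).1 = 1) (h1 : (γ 1).1 = 0)
    {G : unitInterval → ℝ} (hG : ∀ s, 0 ≤ G s) {δ Λ : ℝ} (hδ : 0 < δ) (hδ' : δ ≤ 1 / 2)
    (hch : ∀ s s' : unitInterval, ((γ s).1 ≤ 1 - δ → (γ s').1 ≤ 1 - δ → G s ≤ Λ * G s') ∧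
      (1 - 2 * δ ≤ (γ s).1 → 1 - 2 * δ ≤ (γ s').1 → G s ≤ Λ * G s')) (s s' : unitInterval) :
    G s ≤ max Λ 1 * max Λ 1 * G s' := by
  -- an overlap point `t` with `ρ_t = 1 − 3δ/2`
  have hcont : Continuous fun s : unitInterval => (γ s).1 := continuous_fst.comp hγc
  have hmem : (1 - 3 / 2 * δ : ℝ) ∈ Set.Icc ((fun s : unitInterval => (γ s).1) 1)
      ((fun s : unitInterval => (γ s).1) 0) := by
    simp only [h0, h1]
    constructor <;> nlinarith
  obtain ⟨t, -, ht⟩ := intermediate_value_Icc' zero_le_one hcont.continuousOn hmem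
  simp only at ht
  have ht_bulk : (γ t).1 ≤ 1 - δ := by rw [ht]; nlinarith
  have ht_corner : 1 - 2 * δ ≤ (γ t).1 := by rw [ht]; nlinarith
  -- the charts with the upgraded constant `L = max Λ 1 ≥ 1`
  set L := max Λ 1 with hL
  have hL1 : 1 ≤ L := le_max_right _ _
  have hL0 : 0 ≤ L := zero_le_one.trans hL1
  have bulk : ∀ a b : unitInterval, (γ a).1 ≤ 1 - δ → (γ b).1 ≤ 1 - δ → G a ≤ L * G b :=
    fun a b ha hb => le_max_one_mul ((hch a b).1 ha hb) (hG b)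
  have corner : ∀ a b : unitInterval, 1 - 2 * δ ≤ (γ a).1 → 1 - 2 * δ ≤ (γ b).1 → G a ≤ L * G b :=
    fun a b ha hb => le_max_one_mul ((hch a b).2 ha hb) (hG b)
  have hLL : ∀ b : unitInterval, L * G b ≤ L * L * G b := fun b => by
    have : 0 ≤ L * G b := mul_nonneg hL0 (hG b)
    nlinarith
  -- every parameter lies in (at least) one chart
  have hchart : ∀ a : unitInterval, (γ a).1 ≤ 1 - δ ∨ 1 - 2 * δ ≤ (γ a).1 := fun a => by
    by_cases h : (γ a).1 ≤ 1 - δ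
    · exact Or.inl h
    · exact Or.inr (by rw [not_le] at h; nlinarith)
  rcases hchart s with hs | hs <;> rcases hchart s' with hs' | hs'
  · exact (bulk s s' hs hs').trans (hLL s')
  · calc G s ≤ L * G t := bulk s t hs ht_bulk
      _ ≤ L * (L * G s') := by gcongr; exact corner t s' ht_corner hs'
      _ = L * L * G s' := by ring
  · calc G s ≤ L * G t := corner s t hs ht_corner
      _ ≤ L * (L * G s') := by gcongr; exact bulk t s' ht_bulk hs'
      _ = L * L * G s' := by ring
  · exact (corner s s' hs hs').trans (hLL s')

end MonotoneLine

/-- **The line `monotone-product-coordinates` (registered composition helper).**  The six registered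
stubs of the line — the monotone product representation (`stub_monotoneRep`), the first-order slope
bounds (`stub_slopeBounds`), THE BET (`stub_bet`), the corner BET (`stub_cornerBet`), the Kesten patch at
the independent corner (`stub_cornerPatch`) and the Kesten window on the independent slice `ρ = 0`
(`stub_windowAtRhoZero`), their signatures inlined verbatim and in this order — imply the crux
`GradientComparability` BY NAME: the slope bounds are `hSB hMR`, the level-set comparability is the
landed `stub_levelSetTransport hBET hCB hCP`, `monotoneLine_charts` supplies the bulk and corner charts,
`MonotoneLine.overlap` glues them into clause (i), and clause (ii) follows from clause (i) at the
endpoint `γ 1 = (0,½)` and `divergesAt_zero_half`. -/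
theorem GradientComparability_of_monotoneLine :
    (∀ k : ℕ, ∀ ρ ∈ Set.Icc (0 : ℝ) 1, ∀ c ∈ Set.Icc (0 : ℝ) 1, M k ρ c = (prodBernoulli (fun i :
    Site 2 × Fin 2 × Fin 3 => if i.2.2 = 0 then (if ax k (i.1, i.2.1) then half else Set.projIcc (0
    : ℝ) 1 zero_le_one c) else if i.2.2 = 1 then Set.projIcc (0 : ℝ) 1 zero_le_one (ρ / 2) else
    Set.projIcc (0 : ℝ) 1 zero_le_one ((2 - 2 * ρ) / (2 - ρ)))).map (fun S : Set (Site 2 × Fin 2 ×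
    Fin 3) => ({e | ∃ (v : Site 2) (d : Fin 2), e = s(v, v + (if d = 0 then ![1, 0] else ![0, 1])) ∧
    (if ax k (v, d) then ((tb k (v, d), d, (1 : Fin 3)) ∈ S ∨ ((tb k (v, d), d, (2 : Fin 3)) ∈ S ∧
    (v, d, (0 : Fin 3)) ∈ S)) else (v, d, (0 : Fin 3)) ∈ S)} : BondConfig (Site 2)))) → ((∀ k : ℕ, ∀
    ρ ∈ Set.Icc (0 : ℝ) 1, ∀ c ∈ Set.Icc (0 : ℝ) 1, M k ρ c = (prodBernoulli (fun i : Site 2 × Fin 2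
    × Fin 3 => if i.2.2 = 0 then (if ax k (i.1, i.2.1) then half else Set.projIcc (0 : ℝ) 1
    zero_le_one c) else if i.2.2 = 1 then Set.projIcc (0 : ℝ) 1 zero_le_one (ρ / 2) else Set.projIcc
    (0 : ℝ) 1 zero_le_one ((2 - 2 * ρ) / (2 - ρ)))).map (fun S : Set (Site 2 × Fin 2 × Fin 3) => ({e
    | ∃ (v : Site 2) (d : Fin 2), e = s(v, v + (if d = 0 then ![1, 0] else ![0, 1])) ∧ (if ax k (v,
    d) then ((tb k (v, d), d, (1 : Fin 3)) ∈ S ∨ ((tb k (v, d), d, (2 : Fin 3)) ∈ S ∧ (v, d, (0 :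
    Fin 3)) ∈ S)) else (v, d, (0 : Fin 3)) ∈ S)} : BondConfig (Site 2)))) → ∀ k : ℕ, k = 2 ∨ k = 3 →
    ∀ γ : unitInterval → ℝ × ℝ, PathOK k γ → ∀ (m : ℕ) (F : Fin m → Quad (Set.univ : Set ℂ)), 0 < m
    → (∀ δ : ℝ, 0 < δ → δ ≤ 1 / 2 → ∃ C η₁ : ℝ, 0 < η₁ ∧ ∀ η ∈ Set.Ioo 0 η₁, ∀ s : unitInterval, (γ
    s).1 ≤ 1 - δ → |Dρ k m F η (γ s)| ≤ C * Dc k m F η (γ s)) ∧ (∃ δ : ℝ, 0 < δ ∧ δ ≤ 1 / 4 ∧ ∀ vlo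
    vhi : ℝ, 0 < vlo → vlo < vhi → vhi < 1 → ∃ C η₁ : ℝ, 0 < η₁ ∧ ∀ η ∈ Set.Ioo 0 η₁, ∀ ρ ∈ Set.Icc
    (1 - 2 * δ) 1, ∀ c ∈ Set.Icc (0 : ℝ) 1, P k m F η ρ c ∈ Set.Icc vlo vhi → |Dc k m F η (ρ, c)| ≤
    C * |Dρ k m F η (ρ, c)|)) → (∀ k : ℕ, k = 2 ∨ k = 3 → ∀ γ : unitInterval → ℝ × ℝ, PathOK k γ → ∀
    (m : ℕ) (F : Fin m → Quad (Set.univ : Set ℂ)), 0 < m → ∀ δ : ℝ, 0 < δ → δ ≤ 1 / 2 → ∀ vlo vhi :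
    ℝ, 0 < vlo → vlo < vhi → vhi < 1 → ∃ Θ η₁ : ℝ, 0 ≤ Θ ∧ 0 < η₁ ∧ ∀ η ∈ Set.Ioo 0 η₁, ∀ ρ ∈
    Set.Icc (0 : ℝ) (1 - δ), ∀ c ∈ Set.Icc (0 : ℝ) 1, ∀ c' ∈ Set.Icc (0 : ℝ) 1, P k m F η ρ c ∈
    Set.Icc vlo vhi → P k m F η ρ c' ∈ Set.Icc vlo vhi → |Dρ k m F η (ρ, c) / Dc k m F η (ρ, c) - Dρ
    k m F η (ρ, c') / Dc k m F η (ρ, c')| ≤ Θ * |c - c'|) → (∀ k : ℕ, k = 2 ∨ k = 3 → ∀ γ :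
    unitInterval → ℝ × ℝ, PathOK k γ → ∀ (m : ℕ) (F : Fin m → Quad (Set.univ : Set ℂ)), 0 < m → ∃ δ
    : ℝ, 0 < δ ∧ δ ≤ 1 / 4 ∧ ∀ vlo vhi : ℝ, 0 < vlo → vlo < vhi → vhi < 1 → ∃ Θ η₁ : ℝ, 0 ≤ Θ ∧ 0 <
    η₁ ∧ ∀ η ∈ Set.Ioo 0 η₁, ∀ c ∈ Set.Icc (0 : ℝ) 1, ∀ ρ ∈ Set.Icc (1 - 2 * δ) 1, ∀ ρ' ∈ Set.Icc (1
    - 2 * δ) 1, P k m F η ρ c ∈ Set.Icc vlo vhi → P k m F η ρ' c ∈ Set.Icc vlo vhi → Dρ k m F η (ρ,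
    c) ≠ 0 ∧ |Dc k m F η (ρ, c) / Dρ k m F η (ρ, c) - Dc k m F η (ρ', c) / Dρ k m F η (ρ', c)| ≤ Θ *
    |ρ - ρ'|) → (∀ k : ℕ, k = 2 ∨ k = 3 → ∀ (m : ℕ) (F : Fin m → Quad (Set.univ : Set ℂ)), 0 < m → ∀
    vlo vhi : ℝ, 0 < vlo → vlo < vhi → vhi < 1 → ∃ Λ η₁ : ℝ, 0 < η₁ ∧ ∀ η ∈ Set.Ioo 0 η₁, ∀ q ∈
    Set.Icc (0 : ℝ) 1 ×ˢ Set.Icc (0 : ℝ) 1, ∀ q' ∈ Set.Icc (0 : ℝ) 1 ×ˢ Set.Icc (0 : ℝ) 1, (q.1 = 1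
    ∨ q.2 = 0) → (q'.1 = 1 ∨ q'.2 = 0) → P k m F η q.1 q.2 ∈ Set.Icc vlo vhi → P k m F η q'.1 q'.2 ∈
    Set.Icc vlo vhi → |Dρ k m F η q| ≤ Λ * |Dρ k m F η q'|) → (∀ k : ℕ, k = 2 ∨ k = 3 → ∀ (m : ℕ) (F
    : Fin m → Quad (Set.univ : Set ℂ)), 0 < m → ∀ vlo vhi : ℝ, 0 < vlo → vlo < vhi → vhi < 1 → ∃ Λ
    η₁ : ℝ, 0 < η₁ ∧ ∀ η ∈ Set.Ioo 0 η₁, ∀ c ∈ Set.Icc (0 : ℝ) 1, ∀ c' ∈ Set.Icc (0 : ℝ) 1, P k m F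
    η 0 c ∈ Set.Icc vlo vhi → P k m F η 0 c' ∈ Set.Icc vlo vhi → Dc k m F η (0, c) ≤ Λ * Dc k m F η
    (0, c')) → GradientComparability := by
  intro hMR hSB hBET hCB hCP hK0
  rw [gradientComparability_iff]
  intro k hk γ hγ m F hm
  obtain ⟨δ, Λ, η₀, hδ, hδ', hη₀, hch⟩ :=
    monotoneLine_charts (hSB hMR) (stub_levelSetTransport hBET hCB hCP) hCP hK0 k hk γ hγ m F hm
  set L : ℝ := max Λ 1 * max Λ 1 with hL
  have hcomp : ∀ s s' : unitInterval, ∀ η ∈ Set.Ioo 0 η₀,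
      |Dρ k m F η (γ s)| + |Dc k m F η (γ s)| ≤ L * (|Dρ k m F η (γ s')| + |Dc k m F η (γ s')|) :=
    fun s s' η hη =>
      MonotoneLine.overlap hγ.1 (by rw [hγ.2.1]) (by rw [hγ.2.2.1])
        (G := fun s => |Dρ k m F η (γ s)| + |Dc k m F η (γ s)|)
        (fun _ => add_nonneg (abs_nonneg _) (abs_nonneg _)) hδ hδ' (fun a b => hch a b η hη) s s'
  refine ⟨L, η₀, hη₀, hcomp, fun N => ?_⟩
  obtain ⟨η₁, hη₁, hdiv⟩ := divergesAt_zero_half k hk m F hm (L * max N 0)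
  refine ⟨min η₀ η₁, lt_min hη₀ hη₁, fun η hη s => ?_⟩
  have hend : γ 1 = ((0 : ℝ), (1 / 2 : ℝ)) := hγ.2.2.1
  have h1 := hcomp 1 s η ⟨hη.1, lt_of_lt_of_le hη.2 (min_le_left _ _)⟩
  rw [hend] at h1
  have h2 := hdiv η ⟨hη.1, lt_of_lt_of_le hη.2 (min_le_right _ _)⟩
  have hLpos : 0 < L := by positivity
  exact (le_max_left N 0).trans (le_of_mul_le_mul_left (h2.trans h1) hLpos)

end Summit.CriticalPhenomena.CardyFormulaZ2.Theorems.CardySelfRefinement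

end
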